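import Summits.CriticalPhenomena.PercolationContinuityZ3.Theorems.PercNearOneGluingNoHeavyLowerTailSahiSlotCell34Check

/-!
# The cell `(3,4)` in the kernel — certificate shard 11 of 20: the axis-canonical antichains `22951 ≤ a < 23134`

Support file of the one-cut programme (crux `NoHeavyLowerTail`, stmt-CriticalPhenomena-4575; cell `prim-masterthm`, seat P3, gen 19;
`run/shared/lean/prim/prim-masterthm/prim-masterthm-p3/HIERARCHY.md` §27).  COMPUTATIONAL: one `native_decide` running the colouring search
`SahiSlot34.checkRange` of `…SahiSlotCell34Check` on the canonical antichains of `[4]^3` with indices in `[22951, 23134)` (of `40 238`; the twenty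
shards are balanced by work, ≈ 1/20 of the `1.9·10^8` cell updates each).  What a `true` means is spelled out in `…SahiSlotCell34Check` and turned
into `patternForm 3 4 ≥ 0` on the corresponding coloured antichains by the companion soundness / identification / covering files; the twenty shards
together give `SlotPatternPos 3 4` (`…SahiSlotPatternThreeFour`).  External replay: seat C engine `proto34.c` (0 negatives on all shards). [this work]
-/

namespace Summit.CriticalPhenomena.PercolationContinuityZ3.Theorems

namespace SahiSlot34

/-- **Shard 11/20 of the `(3,4)` certificate**: the axis-canonical antichains of `[4]^3` with indices `22951 ≤ a < 23134` pass the colouring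
search — `Φ = patternForm 3 4 ≥ 0` at every restricted-growth 4-colouring of each of them. [this work] -/
theorem checkRange_shard11 : checkRange 22951 183 = true := by
  native_decide

end SahiSlot34

end Summit.CriticalPhenomena.PercolationContinuityZ3.Theorems
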